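import Literature.NumberTheory.LFunctions.Zhang2022.TypedSection08B
import Literature.NumberTheory.LFunctions.Zhang2022.TypedSection08C
import Literature.NumberTheory.LFunctions.Zhang2022.Section8TotientLogMean
import HarnessLib

/-!
# Zhang (2022) §8: three restated named facts discharged by transport along their `Iff.rfl` twins

Topic `Literature/NumberTheory/LFunctions/Zhang2022` (Landau–Siegel audit tree; verdict-neutral).
Y. Zhang, *Discrete mean estimates and the Landau–Siegel zero*, arXiv:2211.02515v1 (2022)
[Zhang2022LandauSiegel] — an unrefereed manuscript under adjudication; nothing here concerns its
Theorems 1–2. PROOF FILE (theorems only; no definition, no named fact, no hypothesis).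

Three named facts of the §8 statement files were typed twice, in two slices, with definitionally equal
bodies; the tree records the identifications as `Iff.rfl` theorems and proves ONE twin of each pair.
This file closes the other twin of each pair:

* `Typed.S8B.EulerFactorIdentity848_holds` — the constant identity of the display before (8.11), p. 48
  (tex L2463), `φ(D)D⁻¹ ∏_{(q,D)=1}(1 − q⁻²) = (6/π²) ∏_{q∣D} q/(q+1)` (`D ≥ 1`): the twin
  `Section8cStatements.Step8u048const` is `Section8cProofs.step8u048const_holds`
  (`Section8TotientLogMean.lean`), the identification is `Typed.S8B.eulerFactorIdentity848_iff`.
* `Section8dStatements.Step8u062_num_holds` — p. 50 (tex L2572), "`c₁₁ = 3.61226 + ε/2`, `|ε| < 10⁻⁵`":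
  the twin `Sec8C.NumC11` is `Sec8C.numC11_holds` (`TypedSection08C.lean`, from the kernel enclosure
  `3.612261 < c₁₁ < 3.612262`), the identification is `Sec8C.numC11_iff`.
* `Section8dStatements.Step8u063_num_holds` — p. 50 (tex L2575), "`c₂₂ = 1.32215 + ε/2`, `|ε| < 10⁻⁵`":
  twin `Sec8C.NumC22` / `Sec8C.numC22_holds` / `Sec8C.numC22_iff`.

(The fourth such pair of the slice, `Sec8C.NumC12 ↔ Section8dStatements.Step8u064_num`, is REFUTED in
the tree — `Sec8C.not_numC12` — and is of course not touched.)

## References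

* Y. Zhang, arXiv:2211.02515v1 (2022), §8 p. 48 display before (8.11) (tex L2463); p. 50, the numerical
  values of `c₁₁`, `c₂₂` (tex L2572, L2575). [cite: Zhang2022LandauSiegel, §8 pp.48–50]
-/

namespace Literature.NumberTheory.LFunctions.Zhang2022

/-- **`Z22:§8.u048` (the constant), supplementary typing DISCHARGED**:
`φ(D)D⁻¹ ∏_{(q,D)=1}(1 − q⁻²) = (6/π²) ∏_{q∣D} q/(q+1)` for every `D ≠ 0`, in the `Typed.S8B` spelling —
transported from `Section8cProofs.step8u048const_holds` along `Typed.S8B.eulerFactorIdentity848_iff`.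
[cite: Zhang2022LandauSiegel, §8 p.48 display before (8.11), tex L2463] -/
theorem Typed.S8B.EulerFactorIdentity848_holds : Typed.S8B.EulerFactorIdentity848 :=
  Typed.S8B.eulerFactorIdentity848_iff.mpr Section8cProofs.step8u048const_holds

/-- **`Z22:§8.u062` DISCHARGED in the `Section8dStatements` spelling**: `c₁₁ = 3.61226 + ε/2` with
`|ε| < 10⁻⁵` — transported from `Sec8C.numC11_holds` along `Sec8C.numC11_iff`.
[cite: Zhang2022LandauSiegel, §8 p.50, tex L2572] -/
theorem Section8dStatements.Step8u062_num_holds : Section8dStatements.Step8u062_num :=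
  Sec8C.numC11_iff.mp Sec8C.numC11_holds

/-- **`Z22:§8.u063` DISCHARGED in the `Section8dStatements` spelling**: `c₂₂ = 1.32215 + ε/2` with
`|ε| < 10⁻⁵` — transported from `Sec8C.numC22_holds` along `Sec8C.numC22_iff`.
[cite: Zhang2022LandauSiegel, §8 p.50, tex L2575] -/
theorem Section8dStatements.Step8u063_num_holds : Section8dStatements.Step8u063_num :=
  Sec8C.numC22_iff.mp Sec8C.numC22_holds

end Literature.NumberTheory.LFunctions.Zhang2022
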